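import Literature.MathematicalPhysics.QuantumFieldTheory.Balaban1983to89.Node00.Record13SepCo
import Literature.MathematicalPhysics.QuantumFieldTheory.Balaban1983to89.Node00.Record13CarriersCo

/-!
# NODE 00 (YM-PLAN Track A) — THE STAGE-13 CARRIER PINS AT THE v1.4 PROVISOS `Provisos₁₃SepCo` (row P11 on print's separated sequences, partition-compatible runs and print's
# (7)-regular data, with the background row AT PRINT'S BACKGROUND `UbgOfRecord₁₃Co`) TRANSPORT ALONG EVERY `X`-RE-BINDING AND EVERY PIN, the datum `datumOfRecord₁₃SepCo` IS
# UP-SIDE (`rfl`), and the v1.4 record `IsRecordOfRecord₁₃CSepCo` is presented at any re-bound ∕ [B10]- ∕ [B13]- ∕ X-pinned Stage-13 Co view — the rev-20 twin leaf of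
# `Record13CarriersSep` §2–§3 under node00-def-T's KEY-RULE-21 (R5) `…Sep… ↦ …SepCo…` and (R2) `toStage5₁₃ ↦ toStage5₁₃Co`
# (seat `pub-ymgap-dag-n10-d` g8, the ₁₃ carriers' declarer of record — dag-lead WORDS-130; director-ym №149∕№150∕№152 (β))

NODE 00 RECORD MODULE at Stage 13, v1.4 vocabulary (node00-def-T g15's `Node00/Record13SepCo.lean` p515749 — RECORD 13 §11 = the proviso rows over the Co edition
`Node00/Record13Co` p515035: support `suppOfRecord₁₃SepCo θ p n s := {W | W ∈ suppOfRecord₁₃ … ∧ Sect2.SeqSeparated θ.ν.M₁ s ∧ Sect2.DataSmall7P … W}`, FLAT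
`structure Stage13Params.Provisos₁₃SepCo` (rows and order of `Provisos₁₃SepMixed` verbatim: the nine core rows, `hM : ∃ a, θ.τ9.M = F.L ^ a`, `hM₁ : θ.ν.M₁ ∣ θ.τ9.M`, and `bg` :=
def-R's ranged `BgProvisoΛ` over that support AT `UbgOfRecord₁₃Co`), `.toCore`, datum `datumOfRecord₁₃SepCo θ h := datumOfRecord₁₃Co θ h.toCore` (`rfl`), record predicate
`IsRecordOfRecord₁₃CSepCo` binding worlds over the Co view `θ.toStage5₁₃Co`; NO bridge from `Provisos₁₃ ∕ ₁₃Sep ∕ ₁₃SepMixed` — their datum reads the U_old background) and this seat's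
`Node00/Record13CarriersCo` (p516386: `toStage5₁₃Co_rebindX ∕ _pin<G>` (`rfl`), `Stage13Params.rebindX_admissible_iff`, the Co views) over `Record13CarriersSep` §1 (p502304: the CORE
PINS `Provisos₁₃Core.rebindX ∕ .pin<G>` — background-free, reused).  THIS LEAF supplies, for the rev-20 consumers that bind worlds at PINNED Stage-13 Co views (dag-n24-c's K1
engine ⁵, dag-n08-c's ∕ dag-n12-d's storeys, dag-n22-e's layer B, this seat's N10 storeys, …), exactly the carrier-side faces they read at the v1.2 key in `Record13CarriersSep` §2–§3:
(i) `Provisos₁₃SepCo.rebindX ∕ .pin<G>` for `<G>` ∈ {B10, Y, Z, W, B8, B12, B8Sub, B13, X3} — FIELD BY FIELD over ALL TWELVE rows: they read `ν`, `τ9`, `ζ`, `ppSel`, `A₁`, `Rz`,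
`Zt`, `γ`, `gOfRecord₁₃`, `EOfRecord₁₃`, `wOfRecord₉`, `settingOfRecord₁₃`, `suppOfRecord₁₃SepCo` (whose (7) clause reads the θ-level letters `θ.s2.cR`, `θ.ν`, `gOfRecord₁₃ F N θ p`
and the averaging of record), `UbgOfRecord₁₃Co`, `PartCompat₁₃` — never `res.X ∕ Y ∕ Z ∕ W`; (ii) `datumOfRecord₁₃SepCo_rebindX ∕ _pin<G>` — ALL `rfl`: THE PINS ARE UP-SIDE at the
v1.4 datum exactly as at every earlier datum; (iii) the v1.4 record at a re-bound Co view: `isRecordOfRecord₁₃CSepCo_rebindX_of_eq ∕ _pinB10_of_eq ∕ _pinB13_of_eq ∕ _pinX3_of_eq`,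
`exists_world_isRecordOfRecord₁₃CSepCo_rebindX ∕ _pinX3` (world bindings `w.up P = upOfRecord₅C F N ((θ.rebindX F N X').toStage5₁₃Co F N) P`).  The [B8″] pin
`Stage13Params.pinB8SubB` (dag-n05-d) is an instance of `rebindX` — its named `SepCo` faces are one line each through `Provisos₁₃SepCo.rebindX` ∕ `datumOfRecord₁₃SepCo_rebindX`,
declared on ask.  APPEND-ONLY: a NEW importing leaf (`Record13SepCo` ⊇ `Record13Co` ⊇ `Record13`; `Record13CarriersCo` ⊇ `Record13CarriersSep` ⊇ … ⊇ `Record13Carriers`);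
NOTHING landed is edited; the v1.1 ∕ v1.2 ∕ v1.3-keyed faces stand verbatim for the siblings.  Generated from this seat's p511721 by `tools/gen_carriers.py` (field list and
bridge existence read off the LANDED module) and concat-checked with `Record13CarriersCo` on the tree — farm rc 0.
[Balaban1988Convergent] = Commun. Math. Phys. **119** (1988) 243–285; [Balaban1989LargeFieldII] = Commun. Math. Phys. **122** (1989) 355–392; [Balaban1985Variational] =
Commun. Math. Phys. **102** (1985) 277–309.

HONEST FRAMING: kernel bookkeeping (structure-instance re-keying and `rfl`); NO estimate; nothing of Bałaban's asserted; the provisos are HYPOTHESIS-SIDE structures, never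
admissibility clauses, never inhabited here; no node discharged; counts unmoved (typed 28∕28 · discharged 5∕27); one finite T⁴ programme at fixed ε — NOT continuum ∕ ℝ⁴ ∕ OS ∕
mass gap ∕ Clay.  No `sorry`, no `axiom`, no `def`, no `instance`, no `notation`.
-/

noncomputable section

namespace Literature.MathematicalPhysics.QuantumFieldTheory.Balaban1983to89.Node00

open T4Continuum AveragingRT T4FiniteEpsInhabited FlowStep FlowStepRuns DagBinding T4DatumAssembly
open scoped Matrix.Norms.L2Operator

variable {F : T4Family} {N : ℕ} [NeZero N]

/-! ## §1. The v1.4 provisos (row P11 on print's sequences with (7)-regular data, background row at print's background) transport along every X-re-binding and every pin; their datum is UP-SIDE -/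

section SepCo

/-- **The v1.4 provisos read no carrier**: they transport along ANY `X`-re-binding (ten rows, field by field; row `bg` reads `γ`, `gOfRecord₁₃`,
`PartCompat₁₃`, `settingOfRecord₁₃`, `Rz`, `τ9`, `suppOfRecord₁₃SepCo`, `UbgOfRecord₁₃Co` — never `res.X`). [cite: Balaban1988Convergent, (2.18) p.257, (2.23)–(2.42) pp.259–262, (3.2)–(3.9) pp.265–266; Balaban1985RegularSpaces, (1.3)–(1.6) p.77 (bookkeeping)] -/
theorem Stage13Params.Provisos₁₃SepCo.rebindX {θ : Stage13Params F N} (h : θ.Provisos₁₃SepCo F N) (X' : B12.RunParams → PrintedCarriersR) :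
    (θ.rebindX F N X').Provisos₁₃SepCo F N :=
  { intPiece := h.intPiece, measω := h.measω, measChi := h.measChi, zetaUnity := h.zetaUnity, zetaAbs := h.zetaAbs, rstep := h.rstep, rzLaws := h.rzLaws,
    ztLaws := h.ztLaws, ztLocal := h.ztLocal, hM := h.hM, hM₁ := h.hM₁, bg := h.bg }

/-- … along the [B10] pin … [cite: Balaban1988Convergent, (2.23)–(2.42) pp.259–262 (bookkeeping)] -/
theorem Stage13Params.Provisos₁₃SepCo.pinB10 {θ : Stage13Params F N} (h : θ.Provisos₁₃SepCo F N) : (θ.pinB10 F N).Provisos₁₃SepCo F N :=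
  h.rebindX _

/-- … the Y pin … [cite: Balaban1988Convergent, (2.23)–(2.42) pp.259–262 (bookkeeping)] -/
theorem Stage13Params.Provisos₁₃SepCo.pinY {θ : Stage13Params F N} (h : θ.Provisos₁₃SepCo F N) (Y₀ : PrintedCarriers9X) : (θ.pinY F N Y₀).Provisos₁₃SepCo F N :=
  { intPiece := h.intPiece, measω := h.measω, measChi := h.measChi, zetaUnity := h.zetaUnity, zetaAbs := h.zetaAbs, rstep := h.rstep, rzLaws := h.rzLaws,
    ztLaws := h.ztLaws, ztLocal := h.ztLocal, hM := h.hM, hM₁ := h.hM₁, bg := h.bg }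

/-- … the Z pin … [cite: Balaban1988Convergent, (2.23)–(2.42) pp.259–262 (bookkeeping)] -/
theorem Stage13Params.Provisos₁₃SepCo.pinZ {θ : Stage13Params F N} (h : θ.Provisos₁₃SepCo F N) (Z₀ : PrintedCarriers11) : (θ.pinZ F N Z₀).Provisos₁₃SepCo F N :=
  { intPiece := h.intPiece, measω := h.measω, measChi := h.measChi, zetaUnity := h.zetaUnity, zetaAbs := h.zetaAbs, rstep := h.rstep, rzLaws := h.rzLaws,
    ztLaws := h.ztLaws, ztLocal := h.ztLocal, hM := h.hM, hM₁ := h.hM₁, bg := h.bg }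

/-- … the W pin … [cite: Balaban1988Convergent, (2.23)–(2.42) pp.259–262 (bookkeeping)] -/
theorem Stage13Params.Provisos₁₃SepCo.pinW {θ : Stage13Params F N} (h : θ.Provisos₁₃SepCo F N) (W₀ : B12.RunParams → PrintedCarriers15) :
    (θ.pinW F N W₀).Provisos₁₃SepCo F N :=
  { intPiece := h.intPiece, measω := h.measω, measChi := h.measChi, zetaUnity := h.zetaUnity, zetaAbs := h.zetaAbs, rstep := h.rstep, rzLaws := h.rzLaws,
    ztLaws := h.ztLaws, ztLocal := h.ztLocal, hM := h.hM, hM₁ := h.hM₁, bg := h.bg }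

/-- … the [B8] pin … [cite: Balaban1988Convergent, (2.23)–(2.42) pp.259–262 (bookkeeping)] -/
theorem Stage13Params.Provisos₁₃SepCo.pinB8 {θ : Stage13Params F N} (h : θ.Provisos₁₃SepCo F N) (lam : ResidB8 θ.toStage3Params) : (θ.pinB8 F N lam).Provisos₁₃SepCo F N :=
  h.rebindX _

/-- … the [B12] pin … [cite: Balaban1988Convergent, (2.23)–(2.42) pp.259–262 (bookkeeping)] -/
theorem Stage13Params.Provisos₁₃SepCo.pinB12 {θ : Stage13Params F N} (h : θ.Provisos₁₃SepCo F N) (lam : ResidB12 F N θ.τ9.M) : (θ.pinB12 F N lam).Provisos₁₃SepCo F N :=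
  h.rebindX _

/-- … the [B8′] pin … [cite: Balaban1988Convergent, (2.23)–(2.42) pp.259–262 (bookkeeping)] -/
theorem Stage13Params.Provisos₁₃SepCo.pinB8Sub {θ : Stage13Params F N} (h : θ.Provisos₁₃SepCo F N) (lam : ResidB8 θ.toStage3Params) : (θ.pinB8Sub F N lam).Provisos₁₃SepCo F N :=
  h.rebindX _

/-- … the [B13] pin … [cite: Balaban1988Convergent, (2.23)–(2.42) pp.259–262; Balaban1988RG2Cluster, Lemmas 1–3 pp.9–20 (bookkeeping)] -/
theorem Stage13Params.Provisos₁₃SepCo.pinB13 {θ : Stage13Params F N} (h : θ.Provisos₁₃SepCo F N) (lam : B12.RunParams → ResidB13 θ.toStage3Params) :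
    (θ.pinB13 F N lam).Provisos₁₃SepCo F N :=
  h.rebindX _

/-- … and the one-level X-pin of the three carrier groups of record. [cite: Balaban1988Convergent, (2.23)–(2.42) pp.259–262 (bookkeeping)] -/
theorem Stage13Params.Provisos₁₃SepCo.pinX3 {θ : Stage13Params F N} (h : θ.Provisos₁₃SepCo F N) (lam8 : ResidB8 θ.toStage3Params) (lam12 : ResidB12 F N θ.τ9.M)
    (lam13 : B12.RunParams → ResidB13 θ.toStage3Params) : (θ.pinX3 F N lam8 lam12 lam13).Provisos₁₃SepCo F N :=
  h.rebindX _

variable (F N)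

/-- **THE v1.4 DATUM DOES NOT READ THE CARRIER BUNDLE `X`** (`rfl`, once, at a generic re-binding). [cite: Balaban1989LargeFieldII, Thm 1 + (0.1) pp.355–356 (bookkeeping)] -/
theorem datumOfRecord₁₃SepCo_rebindX (θ : Stage13Params F N) (h : θ.Provisos₁₃SepCo F N) (X' : B12.RunParams → PrintedCarriersR)
    (h' : (θ.rebindX F N X').Provisos₁₃SepCo F N) : datumOfRecord₁₃SepCo F N (θ.rebindX F N X') h' = datumOfRecord₁₃SepCo F N θ h := rfl

/-- **THE PINS ARE UP-SIDE at the v1.4 datum**: the [B10] pin (`rfl`) … [cite: Balaban1989LargeFieldII, Thm 1 + (0.1) pp.355–356; Balaban1985UV3, Thm 1 p.257 (bookkeeping)] -/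
theorem datumOfRecord₁₃SepCo_pinB10 (θ : Stage13Params F N) (h : θ.Provisos₁₃SepCo F N) :
    datumOfRecord₁₃SepCo F N (θ.pinB10 F N) h.pinB10 = datumOfRecord₁₃SepCo F N θ h :=
  datumOfRecord₁₃SepCo_rebindX F N θ h _ h.pinB10

/-- … the Y pin (`rfl`) … [cite: Balaban1989LargeFieldII, Thm 1 + (0.1) pp.355–356 (bookkeeping)] -/
theorem datumOfRecord₁₃SepCo_pinY (θ : Stage13Params F N) (h : θ.Provisos₁₃SepCo F N) (Y₀ : PrintedCarriers9X) :
    datumOfRecord₁₃SepCo F N (θ.pinY F N Y₀) (h.pinY Y₀) = datumOfRecord₁₃SepCo F N θ h := rfl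

/-- … the Z pin (`rfl`) … [cite: Balaban1989LargeFieldII, Thm 1 + (0.1) pp.355–356 (bookkeeping)] -/
theorem datumOfRecord₁₃SepCo_pinZ (θ : Stage13Params F N) (h : θ.Provisos₁₃SepCo F N) (Z₀ : PrintedCarriers11) :
    datumOfRecord₁₃SepCo F N (θ.pinZ F N Z₀) (h.pinZ Z₀) = datumOfRecord₁₃SepCo F N θ h := rfl

/-- … the W pin (`rfl`) … [cite: Balaban1989LargeFieldII, Thm 1 + (0.1) pp.355–356 (bookkeeping)] -/
theorem datumOfRecord₁₃SepCo_pinW (θ : Stage13Params F N) (h : θ.Provisos₁₃SepCo F N) (W₀ : B12.RunParams → PrintedCarriers15) :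
    datumOfRecord₁₃SepCo F N (θ.pinW F N W₀) (h.pinW W₀) = datumOfRecord₁₃SepCo F N θ h := rfl

/-- … the [B8] pin (`rfl`) … [cite: Balaban1989LargeFieldII, Thm 1 + (0.1) pp.355–356 (bookkeeping)] -/
theorem datumOfRecord₁₃SepCo_pinB8 (θ : Stage13Params F N) (h : θ.Provisos₁₃SepCo F N) (lam : ResidB8 θ.toStage3Params) :
    datumOfRecord₁₃SepCo F N (θ.pinB8 F N lam) (h.pinB8 lam) = datumOfRecord₁₃SepCo F N θ h :=
  datumOfRecord₁₃SepCo_rebindX F N θ h _ (h.pinB8 lam)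

/-- … the [B12] pin (`rfl`) … [cite: Balaban1989LargeFieldII, Thm 1 + (0.1) pp.355–356 (bookkeeping)] -/
theorem datumOfRecord₁₃SepCo_pinB12 (θ : Stage13Params F N) (h : θ.Provisos₁₃SepCo F N) (lam : ResidB12 F N θ.τ9.M) :
    datumOfRecord₁₃SepCo F N (θ.pinB12 F N lam) (h.pinB12 lam) = datumOfRecord₁₃SepCo F N θ h :=
  datumOfRecord₁₃SepCo_rebindX F N θ h _ (h.pinB12 lam)

/-- … the [B8′] pin (`rfl`) … [cite: Balaban1989LargeFieldII, Thm 1 + (0.1) pp.355–356 (bookkeeping)] -/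
theorem datumOfRecord₁₃SepCo_pinB8Sub (θ : Stage13Params F N) (h : θ.Provisos₁₃SepCo F N) (lam : ResidB8 θ.toStage3Params) :
    datumOfRecord₁₃SepCo F N (θ.pinB8Sub F N lam) (h.pinB8Sub lam) = datumOfRecord₁₃SepCo F N θ h :=
  datumOfRecord₁₃SepCo_rebindX F N θ h _ (h.pinB8Sub lam)

/-- … the [B13] pin (`rfl`) … [cite: Balaban1989LargeFieldII, Thm 1 + (0.1) pp.355–356; Balaban1988RG2Cluster, Lemmas 1–3 pp.9–20 (bookkeeping)] -/
theorem datumOfRecord₁₃SepCo_pinB13 (θ : Stage13Params F N) (h : θ.Provisos₁₃SepCo F N) (lam : B12.RunParams → ResidB13 θ.toStage3Params) :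
    datumOfRecord₁₃SepCo F N (θ.pinB13 F N lam) (h.pinB13 lam) = datumOfRecord₁₃SepCo F N θ h :=
  datumOfRecord₁₃SepCo_rebindX F N θ h _ (h.pinB13 lam)

/-- … and the one-level X-pin (`rfl`). [cite: Balaban1989LargeFieldII, Thm 1 + (0.1) pp.355–356 (bookkeeping)] -/
theorem datumOfRecord₁₃SepCo_pinX3 (θ : Stage13Params F N) (h : θ.Provisos₁₃SepCo F N) (lam8 : ResidB8 θ.toStage3Params) (lam12 : ResidB12 F N θ.τ9.M)
    (lam13 : B12.RunParams → ResidB13 θ.toStage3Params) :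
    datumOfRecord₁₃SepCo F N (θ.pinX3 F N lam8 lam12 lam13) (h.pinX3 lam8 lam12 lam13) = datumOfRecord₁₃SepCo F N θ h :=
  datumOfRecord₁₃SepCo_rebindX F N θ h _ (h.pinX3 lam8 lam12 lam13)

end SepCo

/-! ## §2. The v1.4 record `IsRecordOfRecord₁₃CSepCo` presented at a re-bound ∕ pinned Stage-13 view (same datum, `datumOfRecord₁₃SepCo_rebindX`) -/

section Records

variable (F N)

/-- **Pointed form, generic re-binding, v1.4 vocabulary**: a world with def-T's pointed clauses — construction `(datumOfRecord₁₃SepCo θ h).C`, window `0 < w.γ ≤ θ.γ`, block size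
`θ.L` — whose upstream blocks are the C-binding over the Stage-13 Co view of the RE-BOUND parameters IS a v1.4 ₁₃C record at `datumOfRecord₁₃SepCo θ h` (presenting parameter
`θ.rebindX X'`). [cite: Balaban1989LargeFieldII, Thm 1 + (0.1) pp.355–356 (bookkeeping)] -/
theorem isRecordOfRecord₁₃CSepCo_rebindX_of_eq (θ : Stage13Params F N) (h : θ.Provisos₁₃SepCo F N) (hθ : θ.Admissible F N) (X' : B12.RunParams → PrintedCarriersR)
    (w : WorldP) (hC : w.C = (datumOfRecord₁₃SepCo F N θ h).C) (hγ : 0 < w.γ ∧ w.γ ≤ θ.γ) (hL : w.L = (θ.L : ℝ))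
    (hup : ∀ P, w.up P = upOfRecord₅C F N ((θ.rebindX F N X').toStage5₁₃Co F N) P) :
    IsRecordOfRecord₁₃CSepCo F N (datumOfRecord₁₃SepCo F N θ h) w :=
  ⟨θ.rebindX F N X', h.rebindX X', (Stage13Params.rebindX_admissible_iff F N θ X').2 hθ, (datumOfRecord₁₃SepCo_rebindX F N θ h X' (h.rebindX X')).symm,
    hC, hγ, hL, hup⟩

/-- **EVERY admissible Stage-13 parameter with the v1.4 provisos presents a v1.4 ₁₃C record at its own datum whose world is bound over ANY re-bound Stage-13 Co view**, any
window `0 < γw ≤ θ.γ`, block size `θ.L`. [cite: Balaban1989LargeFieldII, Thm 1 + (0.1) pp.355–356 (bookkeeping)] -/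
theorem exists_world_isRecordOfRecord₁₃CSepCo_rebindX (θ : Stage13Params F N) (h : θ.Provisos₁₃SepCo F N) (hθ : θ.Admissible F N) (X' : B12.RunParams → PrintedCarriersR)
    {γw : ℝ} (hγw : 0 < γw ∧ γw ≤ θ.γ) :
    ∃ w : WorldP, IsRecordOfRecord₁₃CSepCo F N (datumOfRecord₁₃SepCo F N θ h) w ∧ w.γ = γw ∧ w.L = (θ.L : ℝ) ∧
      ∀ P, w.up P = upOfRecord₅C F N ((θ.rebindX F N X').toStage5₁₃Co F N) P := by
  obtain ⟨w₀⟩ := nonempty_worldP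
  exact ⟨{ w₀ with
      C := (datumOfRecord₁₃SepCo F N θ h).C, γ := γw, L := (θ.L : ℝ), one_lt_L := by exact_mod_cast θ.hL.2,
      up := fun P => upOfRecord₅C F N ((θ.rebindX F N X').toStage5₁₃Co F N) P },
    isRecordOfRecord₁₃CSepCo_rebindX_of_eq F N θ h hθ X' _ rfl hγw rfl (fun _ => rfl), rfl, rfl, fun _ => rfl⟩

/-- The [B10] instance (dag-n08-c's N08 ₁₃ storeys read it by name). [cite: Balaban1989LargeFieldII, Thm 1 + (0.1) pp.355–356; Balaban1985UV3, Thm 1 p.257 (bookkeeping)] -/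
theorem isRecordOfRecord₁₃CSepCo_pinB10_of_eq (θ : Stage13Params F N) (h : θ.Provisos₁₃SepCo F N) (hθ : θ.Admissible F N)
    (w : WorldP) (hC : w.C = (datumOfRecord₁₃SepCo F N θ h).C) (hγ : 0 < w.γ ∧ w.γ ≤ θ.γ) (hL : w.L = (θ.L : ℝ))
    (hup : ∀ P, w.up P = upOfRecord₅C F N ((θ.pinB10 F N).toStage5₁₃Co F N) P) :
    IsRecordOfRecord₁₃CSepCo F N (datumOfRecord₁₃SepCo F N θ h) w :=
  isRecordOfRecord₁₃CSepCo_rebindX_of_eq F N θ h hθ _ w hC hγ hL hup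

/-- The [B13] instance (this seat's N10 ₁₃ storeys read it by name). [cite: Balaban1989LargeFieldII, Thm 1 + (0.1) pp.355–356; Balaban1988RG2Cluster, Lemmas 1–3 pp.9–20 (bookkeeping)] -/
theorem isRecordOfRecord₁₃CSepCo_pinB13_of_eq (θ : Stage13Params F N) (h : θ.Provisos₁₃SepCo F N) (hθ : θ.Admissible F N)
    (lam : B12.RunParams → ResidB13 θ.toStage3Params) (w : WorldP) (hC : w.C = (datumOfRecord₁₃SepCo F N θ h).C) (hγ : 0 < w.γ ∧ w.γ ≤ θ.γ) (hL : w.L = (θ.L : ℝ))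
    (hup : ∀ P, w.up P = upOfRecord₅C F N ((θ.pinB13 F N lam).toStage5₁₃Co F N) P) :
    IsRecordOfRecord₁₃CSepCo F N (datumOfRecord₁₃SepCo F N θ h) w :=
  isRecordOfRecord₁₃CSepCo_rebindX_of_eq F N θ h hθ _ w hC hγ hL hup

/-- The X-pinned instance (dag-n24-c's K1 engine closers read it by name). [cite: Balaban1989LargeFieldII, Thm 1 + (0.1) pp.355–356 (bookkeeping)] -/
theorem isRecordOfRecord₁₃CSepCo_pinX3_of_eq (θ : Stage13Params F N) (h : θ.Provisos₁₃SepCo F N) (hθ : θ.Admissible F N) (lam8 : ResidB8 θ.toStage3Params)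
    (lam12 : ResidB12 F N θ.τ9.M) (lam13 : B12.RunParams → ResidB13 θ.toStage3Params) (w : WorldP) (hC : w.C = (datumOfRecord₁₃SepCo F N θ h).C)
    (hγ : 0 < w.γ ∧ w.γ ≤ θ.γ) (hL : w.L = (θ.L : ℝ)) (hup : ∀ P, w.up P = upOfRecord₅C F N ((θ.pinX3 F N lam8 lam12 lam13).toStage5₁₃Co F N) P) :
    IsRecordOfRecord₁₃CSepCo F N (datumOfRecord₁₃SepCo F N θ h) w :=
  isRecordOfRecord₁₃CSepCo_rebindX_of_eq F N θ h hθ _ w hC hγ hL hup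

/-- Every admissible Stage-13 parameter with the v1.4 provisos presents a v1.4 ₁₃C record of its own datum over the X-pinned Stage-13 Co view, any window `0 < γw ≤ θ.γ`,
block size `θ.L`. [cite: Balaban1989LargeFieldII, Thm 1 + (0.1) pp.355–356 (bookkeeping)] -/
theorem exists_world_isRecordOfRecord₁₃CSepCo_pinX3 (θ : Stage13Params F N) (h : θ.Provisos₁₃SepCo F N) (hθ : θ.Admissible F N) (lam8 : ResidB8 θ.toStage3Params)
    (lam12 : ResidB12 F N θ.τ9.M) (lam13 : B12.RunParams → ResidB13 θ.toStage3Params) {γw : ℝ} (hγw : 0 < γw ∧ γw ≤ θ.γ) :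
    ∃ w : WorldP, IsRecordOfRecord₁₃CSepCo F N (datumOfRecord₁₃SepCo F N θ h) w ∧ w.γ = γw ∧ w.L = (θ.L : ℝ) ∧
      ∀ P, w.up P = upOfRecord₅C F N ((θ.pinX3 F N lam8 lam12 lam13).toStage5₁₃Co F N) P :=
  exists_world_isRecordOfRecord₁₃CSepCo_rebindX F N θ h hθ _ hγw

end Records

end Literature.MathematicalPhysics.QuantumFieldTheory.Balaban1983to89.Node00

end
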